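import Mathlib
import Literature.Probability.RandomPlanarGeometry.LoopEnsembleSpace
import Literature.Probability.RandomPlanarGeometry.LoopConfigurations
import HarnessLib

/-!
# Soft machine, brick 5: `d_CN`-closeness from Hausdorff closeness of finitely many typed windowed collections

Crux `Summit.CriticalPhenomena.CardyFormulaZ2.Theses.CardyMagicRigidity.NestingRigidity`
(stmt-CriticalPhenomena-4835), line `positive-cone-weight-doubling`, registered stub `stub_tamePrecompactness`
(SOFT MACHINE).  The deterministic heart of the machine.  The limit presentation reads a typed loop configuration
off a point `y` of the product `ℕ × Fin 2 → LoopSpace ℂ` (window `m`, type `i`) by the rule, written inline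
throughout (no definition is introduced):

  `Φ(y).F i = ⋃ₘ {unbased loop of c | c ∈ y (m, i) a loop, range c ⊆ B̄(0, m + 1), ¬ range c ⊆ B̄(0, m − 3/4)}`

— window `m` is RESPONSIBLE for the loops inside `B̄(0, m + 1)` reaching outside `B̄(0, m − 3/4)`; consecutive
responsibilities OVERLAP (by `1/4`), which is what makes the rule robust under perturbations of size `η ≤ 1/4` and
dispenses with any consistency between the windowed collections.  The theorem
`softMachine_isClose_of_coords_close` (registered anchor): if a typed configuration `x` (the whole-plane lattice
configuration) and closed collections `L m i` (its typed windowed collections, window `m ⊇ B(0, m + 2)`-faithful: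
inside `B(0, m + 2)` the members of `L m i` are exactly the loops of `x` of type `i`) satisfy
`hausdorffEDist (L m i) (y (m, i)) < η` for the finitely many windows `m ≤ ⌈1/ε⌉₊ + 1`, where every member of every
`y j` is a loop and `0 < η ≤ min ε (1/4)`, then `d_CN(x, Φ y) ≤ ε` (`LoopConfig.IsClose ε`).  Partners are found
through the Hausdorff closeness; the passage from curve classes to DKKMO's unbased loops is `1`-Lipschitz and
preserves traces, which move by at most `η` (`SoftMachine.range_subset_closedBall_of_dist_le`).
-/

noncomputable section

open MeasureTheory Set Filter Metric TopologicalSpace Function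
open scoped Topology ENNReal NNReal

namespace Summit.CriticalPhenomena.CardyFormulaZ2.Cruxes.NestingRigidity.PositiveConeWeightDoubling

open Literature.Probability.RandomPlanarGeometry

namespace SoftMachine

/-! ### Traces and distances under the passage to unbased loops -/

/-- The unbased loop of a loop class has the same trace. -/
theorem range_mk_mk (c : CurveClass ℂ) (h : c.IsLoop) : (UnbasedLoop.mk (BasedLoop.mk c h)).range = c.range := rfl

/-- The passage from loop classes to unbased loops does not increase distances. -/
theorem dist_mk_mk_le (c c' : CurveClass ℂ) (h : c.IsLoop) (h' : c'.IsLoop) :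
    dist (UnbasedLoop.mk (BasedLoop.mk c h)) (UnbasedLoop.mk (BasedLoop.mk c' h')) ≤ dist c c' := by
  rw [UnbasedLoop.dist_mk_mk]
  exact BasedLoop.dist_le_dist_toCurveClass _ _

/-- Every point of the trace of `c'` is within `dist c c'` of the trace of `c` (`Curve.infDist_range_le`). -/
theorem exists_mem_range_dist_le (c c' : CurveClass ℂ) {x : ℂ} (hx : x ∈ c'.range) :
    ∃ z ∈ c.range, dist x z ≤ dist c c' := by
  obtain ⟨γ, rfl⟩ := CurveClass.surjective_mk c
  obtain ⟨γ', rfl⟩ := CurveClass.surjective_mk c'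
  rw [CurveClass.range_mk] at hx ⊢
  obtain ⟨t, rfl⟩ := Curve.mem_range.1 hx
  obtain ⟨z, hz, hxz⟩ := (CurveClass.mk γ).isCompact_range.exists_infDist_eq_dist (CurveClass.mk γ).range_nonempty (γ' t)
  rw [CurveClass.range_mk] at hz hxz
  refine ⟨z, hz, ?_⟩
  rw [← hxz, CurveClass.dist_mk_mk, dist_comm]
  exact Curve.infDist_range_le γ' γ t

/-- **Traces move by at most the distance of the classes**: if `range c ⊆ B̄(0, a)` and `dist c c' ≤ r` then
`range c' ⊆ B̄(0, a + r)`. -/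
theorem range_subset_closedBall_of_dist_le {c c' : CurveClass ℂ} {a r : ℝ} (ha : c.range ⊆ closedBall (0 : ℂ) a)
    (hr : dist c c' ≤ r) : c'.range ⊆ closedBall (0 : ℂ) (a + r) := by
  intro x hx
  obtain ⟨z, hz, hxz⟩ := exists_mem_range_dist_le c c' hx
  have hz' := ha hz
  rw [mem_closedBall, dist_zero_right] at hz' ⊢
  calc ‖x‖ = ‖(x - z) + z‖ := by rw [sub_add_cancel]
    _ ≤ ‖x - z‖ + ‖z‖ := norm_add_le _ _
    _ ≤ r + a := add_le_add (by rw [← dist_eq_norm]; exact hxz.trans hr) hz'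
    _ = a + r := add_comm _ _

/-- Hausdorff-close closed collections: a member of the first has an `η`-close member of the second. -/
theorem exists_mem_dist_lt_of_edist_lt {L L' : LoopSpace ℂ} {η : ℝ} (h : edist L L' < ENNReal.ofReal η)
    {c : CurveClass ℂ} (hc : c ∈ L) : ∃ c' ∈ L', dist c c' < η := by
  rw [Closeds.edist_eq] at h
  obtain ⟨c', hc', hd⟩ := Metric.exists_edist_lt_of_hausdorffEDist_lt (show c ∈ (L : Set (CurveClass ℂ)) from hc) h
  exact ⟨c', hc', edist_lt_ofReal.1 hd⟩

/-- Hausdorff-close closed collections: a member of the second has an `η`-close member of the first. -/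
theorem exists_mem_dist_lt_of_edist_lt' {L L' : LoopSpace ℂ} {η : ℝ} (h : edist L L' < ENNReal.ofReal η)
    {c' : CurveClass ℂ} (hc' : c' ∈ L') : ∃ c ∈ L, dist c' c < η := by
  rw [edist_comm] at h
  exact exists_mem_dist_lt_of_edist_lt h hc'

end SoftMachine

open SoftMachine in
/-- **Registered anchor** (`softMachine_isClose_of_coords_close`): the deterministic heart of the soft machine, see
the module docstring.  `x` is a typed loop configuration, `L m i` closed collections of curve classes that are
FAITHFUL to `x` inside `B(0, m + 2)` (hypotheses `h1`, `h2`), `y` a point of the product all of whose collections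
consist of loops, Hausdorff-`η`-close to `L` on the windows `m ≤ ⌈1/ε⌉₊ + 1`; then the configuration read off `y`
by the overlapping-responsibility rule is `ε`-close to `x` in DKKMO's sense. -/
theorem softMachine_isClose_of_coords_close : ∀ (x : LoopConfig ℂ) (L : ℕ → Fin 2 → LoopSpace ℂ)
    (y : ℕ × Fin 2 → LoopSpace ℂ) (ε η : ℝ), 0 < ε → 0 < η → η ≤ ε → η ≤ 1 / 4 →
    (∀ j, ∀ c ∈ y j, CurveClass.IsLoop c) →
    (∀ (m : ℕ) (i : Fin 2) (u : UnbasedLoop ℂ), u ∈ x.F i → u.range ⊆ ball (0 : ℂ) (m + 2) →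
      ∃ c ∈ L m i, ∃ h : c.IsLoop, UnbasedLoop.mk (BasedLoop.mk c h) = u) →
    (∀ (m : ℕ) (i : Fin 2) (c : CurveClass ℂ), c ∈ L m i → c.range ⊆ ball (0 : ℂ) (m + 2) →
      ∃ h : c.IsLoop, UnbasedLoop.mk (BasedLoop.mk c h) ∈ x.F i) →
    (∀ (m : ℕ) (i : Fin 2), m ≤ ⌈1 / ε⌉₊ + 1 → edist (L m i) (y (m, i)) < ENNReal.ofReal η) →
    LoopConfig.IsClose ε x
      (⟨fun i ↦ {u | ∃ (m : ℕ), ∃ c ∈ (y (m, i) : Set (CurveClass ℂ)),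
        c.range ⊆ closedBall (0 : ℂ) (m + 1) ∧ ¬ c.range ⊆ closedBall (0 : ℂ) (m - 3 / 4) ∧
          ∃ h : c.IsLoop, UnbasedLoop.mk (BasedLoop.mk c h) = u}⟩ : LoopConfig ℂ) := by
  intro x L y ε η hε hη hηε hη4 hy h1 h2 hclose
  classical
  have hceil : 1 / ε ≤ (⌈1 / ε⌉₊ : ℝ) := Nat.le_ceil _
  intro i
  refine ⟨fun u hu hur ↦ ?_, fun u' hu' hu'r ↦ ?_⟩
  · -- (1) a loop of `x` inside the window `B(0, 1/ε)` has a partner read off `y`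
    have hex : ∃ m : ℕ, u.range ⊆ closedBall (0 : ℂ) (m + 1 / 2) := by
      refine ⟨⌈1 / ε⌉₊, hur.trans (ball_subset_closedBall.trans (closedBall_subset_closedBall ?_))⟩
      linarith
    set m₀ := Nat.find hex with hm₀def
    have hm₀ : u.range ⊆ closedBall (0 : ℂ) (m₀ + 1 / 2) := Nat.find_spec hex
    have hmin : ∀ m < m₀, ¬ u.range ⊆ closedBall (0 : ℂ) (m + 1 / 2) := fun m hm ↦ Nat.find_min hex hm
    have hm₀le : m₀ ≤ ⌈1 / ε⌉₊ + 1 := by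
      have : m₀ ≤ ⌈1 / ε⌉₊ := Nat.find_min' hex
        (hur.trans (ball_subset_closedBall.trans (closedBall_subset_closedBall (by linarith))))
      omega
    obtain ⟨c, hc, h, hcu⟩ := h1 m₀ i u hu
      (hm₀.trans (closedBall_subset_ball (by linarith)))
    obtain ⟨c', hc', hd⟩ := exists_mem_dist_lt_of_edist_lt (hclose m₀ i hm₀le) hc
    have h' : c'.IsLoop := hy _ c' hc'
    have hcr : c.range ⊆ closedBall (0 : ℂ) (m₀ + 1 / 2) := by rwa [← range_mk_mk c h, hcu]
    refine ⟨UnbasedLoop.mk (BasedLoop.mk c' h'), ⟨m₀, c', hc', ?_, ?_, h', rfl⟩, ?_⟩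
    · exact (range_subset_closedBall_of_dist_le hcr hd.le).trans (closedBall_subset_closedBall (by linarith))
    · intro hsub
      have hback : c.range ⊆ closedBall (0 : ℂ) ((m₀ : ℝ) - 3 / 4 + η) :=
        range_subset_closedBall_of_dist_le hsub (by rw [dist_comm]; exact hd.le)
      rw [← hcu, range_mk_mk] at hmin hm₀
      rcases Nat.eq_zero_or_pos m₀ with h0 | hpos
      · have hempty : closedBall (0 : ℂ) ((m₀ : ℝ) - 3 / 4 + η) = ∅ := by
          rw [closedBall_eq_empty, h0]; push_cast; linarith
        rw [hempty, subset_empty_iff] at hback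
        exact absurd hback c.range_nonempty.ne_empty
      · refine hmin (m₀ - 1) (by omega) (hback.trans (closedBall_subset_closedBall ?_))
        have hcast : ((m₀ - 1 : ℕ) : ℝ) = (m₀ : ℝ) - 1 := by
          rw [Nat.cast_sub (by omega), Nat.cast_one]
        rw [hcast]; linarith
    · calc u.udist (UnbasedLoop.mk (BasedLoop.mk c' h'))
          ≤ dist u (UnbasedLoop.mk (BasedLoop.mk c' h')) := UnbasedLoop.udist_le_dist _ _
        _ = dist (UnbasedLoop.mk (BasedLoop.mk c h)) (UnbasedLoop.mk (BasedLoop.mk c' h')) := by rw [hcu]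
        _ ≤ dist c c' := dist_mk_mk_le c c' h h'
        _ ≤ ε := hd.le.trans hηε
  · -- (2) a loop read off `y` inside the window has a partner in `x`
    obtain ⟨m', c', hc', hr1, hr2, h', rfl⟩ := hu'
    rw [range_mk_mk] at hu'r
    have hm'le : m' ≤ ⌈1 / ε⌉₊ + 1 := by
      by_contra hlt
      rw [not_le] at hlt
      refine hr2 (hu'r.trans (ball_subset_closedBall.trans (closedBall_subset_closedBall ?_)))
      have : (⌈1 / ε⌉₊ : ℝ) + 2 ≤ m' := by exact_mod_cast hlt
      linarith
    obtain ⟨c, hc, hd⟩ := exists_mem_dist_lt_of_edist_lt' (hclose m' i hm'le) hc'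
    have hcr : c.range ⊆ ball (0 : ℂ) (m' + 2) :=
      (range_subset_closedBall_of_dist_le hr1 hd.le).trans (closedBall_subset_ball (by linarith))
    obtain ⟨h, hmem⟩ := h2 m' i c hc hcr
    refine ⟨UnbasedLoop.mk (BasedLoop.mk c h), hmem, ?_⟩
    calc (UnbasedLoop.mk (BasedLoop.mk c' h')).udist (UnbasedLoop.mk (BasedLoop.mk c h))
        ≤ dist (UnbasedLoop.mk (BasedLoop.mk c' h')) (UnbasedLoop.mk (BasedLoop.mk c h)) :=
          UnbasedLoop.udist_le_dist _ _
      _ ≤ dist c' c := dist_mk_mk_le c' c h' h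
      _ ≤ ε := hd.le.trans hηε

end Summit.CriticalPhenomena.CardyFormulaZ2.Cruxes.NestingRigidity.PositiveConeWeightDoubling

end
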